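import Mathlib
import Summits.Ventures.HodgeRepro2.LevelPositivity
import Summits.Ventures.HodgeRepro2.LevelMultiplicity
import Summits.Ventures.HodgeRepro2.LiuOscillator
import Summits.Ventures.HodgeRepro2.T6B5Data
import Summits.Ventures.HodgeRepro2.T6B5Datum
import Summits.Ventures.HodgeRepro2.T6B5Hyp
import Summits.Ventures.HodgeRepro2.T6B3Hyp
import Summits.Ventures.HodgeRepro2.T6B5Main
import Summits.Ventures.HodgeRepro2.T6B5Orbit
import Summits.Ventures.HodgeRepro2.T6B5NonIsoHyp
import Summits.Ventures.HodgeRepro2.T6B5CentralToy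

/-!
# T6B5MFold — Tier 6, sub-goal B5: Remark B5.9 (m-fold positivity at one level) over the B5 datum

TIER4 §B5 Remark B5.9 [P]+[C] (NOT used by Theorem A — the fallback of Remark A6(a) / B3 Application): «For every
integer m ≥ 1 there is an open compact K^{(m)} ⊆ K with d(μ_i, K^{(m)}) ≥ m for i = 1, …, 4, provided that the group
Q := E^1 \ (A_E^∞)^1 admits at least m distinct automorphic characters.» The accepted generic counting step is
`LevelPositivity.mFoldPositivity` / `card_le_sum_finrank_invariants` (p388586); over the datum the remark needs, beyond
Def. 4.11, the printed input that the `m` indices `(ε_i, χ^{(j)})` give `m` DISTINCT classes — the tree's `d(μ, K)`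
(`Liu.liuMultiplicity`, t6-p6's reading) sums over the distinct classes — which is the displayed clause (2) of
Thm. 4.18 (`Hyp.Liu2021_Thm4_18_2`, T6B5NonIsoHyp.lean). The `m` characters are the hypothesis, as in print (a
`Finset` of `m` characters of `E^1 \ (A_E^∞)^1`, p2's `Liu.OneCharacter`); the deduction that infinitely many exist
(E16 / E21) is the accepted generic `LevelCharacterSeparation` (p388853) + prose and is not re-proved here.

* `withChar t χ'` — the triple `(μ, ε, χ')` (Remark B5.9's `(μ_i, ε_i, χ^{(j)})`); admissibility does not involve `χ`
  (`isAdmissible_withChar`, (a.4));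
* `osc_withChar_injOn` — distinct characters, distinct classes (the display);
* `B5_mfold` — Remark B5.9: one compact open level `K ≤ K₀` such that at every compact open `K' ≤ K` and for each
  `i`, every `ω(μ_i, ε_i, χ^{(j)})` has non-zero `K'`-invariants and every exhausting set `T` for `μ_i` at `K'` has
  `d(μ_i, K') = liuMultiplicity T K' ≥ m` (the common level of Lemma B5.5(3) over all `(i, j)`, Lemma B5.7's count);
* `B5_mfold_cor420` — the same inside t6-p6's Cor. 4.20 decomposition: the exponent of `μ_i` is `≥ m`;
* `toyModelChar_thm418_2` / `exists_model_mfold` — the display holds on the second toy (classes = triples) jointly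
  with Def. 4.11 (README §10.5(ii)(c),(d)); on the accepted one-class `toyModel` it is not a toy for this display
  (all classes coincide) — reported.
README §8(d): uses an L-value-free non-vanishing device: NO.
-/

namespace Summit.Ventures.HodgeRepro2.T6.B5MFold

open Summit.Ventures.HodgeRepro2.LevelPositivity Summit.Ventures.HodgeRepro2.ShimuraData
  Summit.Ventures.HodgeRepro2.T6.B5Data Summit.Ventures.HodgeRepro2.T6.B5Datum
  Summit.Ventures.HodgeRepro2.T6.Hyp Summit.Ventures.HodgeRepro2.T6.B5Main Summit.Ventures.HodgeRepro2.T6.B5Orbit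
open Module

universe u

variable {K : Type u} [Field K] [NumberField K] [NumberField.IsCMField K] {c : Liu.IdeleConjugation K}
  {χEF : Liu.QuadraticCharacter K c}

/-- The triple `(μ, ε, χ')`: `t` with its character replaced by `χ'` (Remark B5.9's `(μ_i, ε_i, χ^{(j)})`). -/
def withChar (t : Liu.OscillatorTriple K c χEF) (χ' : Liu.OneCharacter K c) : Liu.OscillatorTriple K c χEF :=
  { t with χ := χ' }

/-- `withChar` keeps the first component `μ` of the triple. -/
@[simp] theorem withChar_μ (t : Liu.OscillatorTriple K c χEF) (χ' : Liu.OneCharacter K c) :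
    (withChar t χ').μ = t.μ := rfl

/-- `withChar` keeps the representative `e` of the triple. -/
@[simp] theorem withChar_e (t : Liu.OscillatorTriple K c χEF) (χ' : Liu.OneCharacter K c) :
    (withChar t χ').e = t.e := rfl

/-- `withChar` replaces the character of the triple by `χ'`. -/
@[simp] theorem withChar_χ (t : Liu.OscillatorTriple K c χEF) (χ' : Liu.OneCharacter K c) :
    (withChar t χ').χ = χ' := rfl

/-- μ-admissibility of `ε` does not involve `χ` (TIER4 §B5 (a.4)): replacing the character keeps admissibility. -/
theorem isAdmissible_withChar {t : Liu.OscillatorTriple K c χEF} (ht : Liu.OscillatorTriple.IsAdmissible K t)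
    (χ' : Liu.OneCharacter K c) : Liu.OscillatorTriple.IsAdmissible K (withChar t χ') := ht

variable (𝓛 : LiuAlbaneseDatum K c χEF)

/-- Distinct characters give distinct classes `ω(μ, ε, χ')` (the displayed Thm. 4.18(2)). -/
theorem osc_withChar_injOn (h4182 : Liu2021_Thm4_18_2 𝓛) {t : Liu.OscillatorTriple K c χEF}
    (ht : Liu.OscillatorTriple.IsAdmissible K t) (S : Finset (Liu.OneCharacter K c)) :
    Set.InjOn (fun χ' => 𝓛.osc (withChar t χ')) ↑S := fun χ₁ _ χ₂ _ h =>
  h4182 _ _ (isAdmissible_withChar ht χ₁) (isAdmissible_withChar ht χ₂) rfl rfl h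

/-- **TIER4 §B5 Remark B5.9 (m-fold positivity at one level).** For `m` distinct characters `χ^{(1)}, …, χ^{(m)}` of
`E^1 \ (A_E^∞)^1` (the `Finset` `S`) there is one compact open level `K ≤ K₀` such that at every compact open
`K' ≤ K` and for each `i`: every `ω(μ_i, ε_i, χ^{(j)})` has non-zero `K'`-invariants, and `d(μ_i, K') ≥ m` for every
exhausting set of classes (Lemma B5.5(3) over all `(i, j)`, Lemma B5.7's count over the `m` distinct classes of the
displayed Thm. 4.18(2)). Inputs by name: the displayed Def. 4.11 and Thm. 4.18(2), B3's four admissible triples. -/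
theorem B5_mfold (h411 : Liu2021_Def4_11 𝓛) (K₀ : OpenSubgroup 𝓛.G) (hK₀ : IsCompact (K₀ : Set 𝓛.G))
    (h4182 : Liu2021_Thm4_18_2 𝓛)
    (t : Fin 4 → Liu.OscillatorTriple K c χEF) (ht : ∀ i, Liu.OscillatorTriple.IsAdmissible K (t i))
    (S : Finset (Liu.OneCharacter K c)) :
    ∃ L : CLevel 𝓛, L.1 ≤ K₀ ∧ ∀ L' : CLevel 𝓛, L' ≤ L → ∀ i,
      (∀ χ' ∈ S, 0 < (shape 𝓛 h411 K₀).dimInv ((shape 𝓛 h411 K₀).osc (withChar (t i) χ')) L') ∧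
      ∀ T : Finset (Liu.OscillatorTriple K c χEF), IsExhausting (shape 𝓛 h411 K₀) (t i).μ T L' →
        S.card ≤ Liu.liuMultiplicity K (shape 𝓛 h411 K₀) T L' := by
  classical
  -- Step 1: non-zero vectors in the representations ω(μ_i, ε_i, χ^{(j)}), indexed by the pairs (i, j).
  let V : (Σ _ : Fin 4, S) → Type := fun x => 𝓛.W (𝓛.osc (withChar (t x.1) x.2.1))
  let ρ : ∀ x : (Σ _ : Fin 4, S), Representation ℂ 𝓛.G (V x) := fun x => 𝓛.ω (𝓛.osc (withChar (t x.1) x.2.1))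
  have hsm : ∀ x, IsSmooth (ρ x) := fun x => (h411 _).2.1
  have hnt : ∀ x, Nontrivial (V x) := fun x => nontrivial_of_isIrreducible (h411 _).1
  choose v hv using fun x => @exists_ne _ (hnt x) (0 : V x)
  -- Step 2: the common level (Lemma B5.5(3)).
  obtain ⟨Kc, hKc, hKle, hKv⟩ := exists_common_level (k := ℂ) V ρ hsm v K₀ hK₀
  refine ⟨⟨Kc, hKc⟩, hKle, ?_⟩
  rintro ⟨L', hL'c⟩ hle i
  have hle' : L' ≤ Kc := hle
  -- Step 3: positivity of every term.
  have hpos : ∀ χ' ∈ S,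
      0 < (shape 𝓛 h411 K₀).dimInv ((shape 𝓛 h411 K₀).osc (withChar (t i) χ')) ⟨L', hL'c⟩ := by
    intro χ' hχ'
    show 0 < finrank ℂ (invariants (𝓛.ω (𝓛.osc (withChar (t i) χ'))) (L' : Subgroup 𝓛.G))
    haveI := hfd_of 𝓛 h411 (withChar (t i) χ') L' hL'c
    exact Nat.lt_of_lt_of_le Nat.zero_lt_one
      (one_le_finrank_invariants _ _ (hv ⟨i, ⟨χ', hχ'⟩⟩)
        (hKv (L' : Subgroup 𝓛.G) (OpenSubgroup.toSubgroup_le.mpr hle') ⟨i, ⟨χ', hχ'⟩⟩))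
  refine ⟨hpos, fun T hT => ?_⟩
  -- Step 4: the m classes are distinct (Thm. 4.18(2)) and lie in the exhausting set's image; Lemma B5.7's count.
  let f : Liu.OneCharacter K c → (shape 𝓛 h411 K₀).Rep := fun χ' => (shape 𝓛 h411 K₀).osc (withChar (t i) χ')
  have hinj : Set.InjOn f ↑S := fun χ₁ h₁ χ₂ h₂ h =>
    osc_withChar_injOn 𝓛 h4182 (ht i) S h₁ h₂ (congrArg Subtype.val h)
  have hsub : S.image f ⊆ T.image (shape 𝓛 h411 K₀).osc := by
    intro r hr
    obtain ⟨χ', hχ', rfl⟩ := Finset.mem_image.mp hr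
    exact hT.2 (withChar (t i) χ') (isAdmissible_withChar (ht i) χ') rfl (hpos χ' hχ')
  calc S.card = (S.image f).card := (Finset.card_image_of_injOn hinj).symm
    _ = ∑ _ ∈ S.image f, 1 := Finset.card_eq_sum_ones _
    _ ≤ ∑ r ∈ S.image f, (shape 𝓛 h411 K₀).dimInv r ⟨L', hL'c⟩ := by
        apply Finset.sum_le_sum
        intro r hr
        obtain ⟨χ', hχ', rfl⟩ := Finset.mem_image.mp hr
        exact hpos χ' hχ'
    _ ≤ ∑ r ∈ T.image (shape 𝓛 h411 K₀).osc, (shape 𝓛 h411 K₀).dimInv r ⟨L', hL'c⟩ :=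
        Finset.sum_le_sum_of_subset_of_nonneg hsub (fun _ _ _ => Nat.zero_le _)
    _ = Liu.liuMultiplicity K (shape 𝓛 h411 K₀) T ⟨L', hL'c⟩ := rfl

/-- **Remark B5.9 inside Cor. 4.20's decomposition.** At every level of `B5_mfold` below `K₀` (n ⩾ 3), t6-p6's
display of Cor. 4.20 over the shape gives representatives and exhausting sets with
`A_{K'} ∼ ∏_μ A_μ^{d(μ,K')}`, and the exponent `d(μ_i, K')` of each `μ_i` is `≥ m`. -/
theorem B5_mfold_cor420 (h411 : Liu2021_Def4_11 𝓛) (K₀ : OpenSubgroup 𝓛.G) (hK₀ : IsCompact (K₀ : Set 𝓛.G))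
    (h4182 : Liu2021_Thm4_18_2 𝓛) (h420 : Liu2021_Cor4_20 (shape 𝓛 h411 K₀)) (hn : 3 ≤ 𝓛.n)
    (t : Fin 4 → Liu.OscillatorTriple K c χEF) (ht : ∀ i, Liu.OscillatorTriple.IsAdmissible K (t i))
    (S : Finset (Liu.OneCharacter K c)) :
    ∃ L : CLevel 𝓛, (shape 𝓛 h411 K₀).IsSmall L ∧ ∀ L' : CLevel 𝓛, L' ≤ L →
      ∃ (reps : Finset (Liu.AutomorphicCharacter K)) (T : Liu.AutomorphicCharacter K →
          Finset (Liu.OscillatorTriple K c χEF)),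
        (∀ μ ∈ reps, Liu.IsWeightOneConjugateSymplectic K c χEF μ) ∧
        (∀ μ, IsExhausting (shape 𝓛 h411 K₀) μ (T μ) L') ∧
        (∀ μ ∈ reps, ∀ μ' ∈ reps, (shape 𝓛 h411 K₀).galOrbit μ μ' → μ = μ') ∧
        (shape 𝓛 h411 K₀).albanese L' =
          ∏ μ ∈ reps, (shape 𝓛 h411 K₀).cmVariety μ ^ Liu.liuMultiplicity K (shape 𝓛 h411 K₀) (T μ) L' ∧
        ∀ i, S.card ≤ Liu.liuMultiplicity K (shape 𝓛 h411 K₀) (T (t i).μ) L' := by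
  obtain ⟨L, hL, h⟩ := B5_mfold 𝓛 h411 K₀ hK₀ h4182 t ht S
  refine ⟨L, hL, fun L' hle => ?_⟩
  have hsmall : (shape 𝓛 h411 K₀).IsSmall L' := le_trans (show L'.1 ≤ L.1 from hle) hL
  obtain ⟨reps, T, h1, h2, h3, -, h5⟩ := cor420_exhausting (shape 𝓛 h411 K₀) h420 hn L' hsmall
  exact ⟨reps, T, h1, h2, h3, h5, fun i => (h L' hle i).2 (T (t i).μ) (h2 (t i).μ)⟩

section Toy

open Summit.Ventures.HodgeRepro2.T6.B5CentralToy

variable (K : Type) [Field K] [NumberField K] [NumberField.IsCMField K] (c : Liu.IdeleConjugation K)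
  (χEF : Liu.QuadraticCharacter K c)

/-- The displayed Thm. 4.18(2) holds on the second toy (classes = the triples, `osc = id`). -/
theorem toyModelChar_thm418_2 : Liu2021_Thm4_18_2 (toyModelChar K c χEF) :=
  fun _ _ _ _ _ _ h => congrArg Liu.OscillatorTriple.χ h

/-- README §10.5(ii)(c),(d) for `B5_mfold`: Def. 4.11 and Thm. 4.18(2) hold jointly on the second toy. -/
theorem exists_model_mfold : ∃ 𝓛 : LiuAlbaneseDatum K c χEF, Liu2021_Def4_11 𝓛 ∧ Liu2021_Thm4_18_2 𝓛 :=
  ⟨toyModelChar K c χEF, (toyModelChar_hypotheses K c χEF).1, toyModelChar_thm418_2 K c χEF⟩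

end Toy

end Summit.Ventures.HodgeRepro2.T6.B5MFold
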